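import Summits.RiemannHypothesis.RiemannHypothesis.Theorems.PfPersistenceRatioUnguardedSettled
import Literature.NumberTheory.LFunctions.WeilWindowSuzukiAsymptoticProofs
import HarnessLib

/-!
# PF persistence — leaf G1.21b `(Z)`-cell: THE SHORT-WINDOW SANDWICH `ζ(a, 1) = log(1/a)·𝟙 + O(1)`

Helper file (`--supports stmt-RiemannHypothesis-19953`); mechanism/rigidity campaign; no RH claims.

The sign-blind RATIO conjuncts of the `(Z)`-cell (gauge `|ε₁| ≤ τ(ε₂ − ε₁)`, modulus `|ε₁| ≤ κ|ε₂|`)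
are SCALE-FREE; the Weil window form at SHORT windows is not.  By Suzuki's small-window asymptotics
(PROVED in the tree, RH-free: `Suzuki2026_thm_1_4_asymptotic_holds`) the bottom of the window `[-a,a]`
is `log(1/a) + O(1)`; this file shows the same for the TOP of `ζ`'s two-dimensional Galerkin block
`ζ(a, N = 1)`.  For `0 < a ≤ 1/4` and every `v : Fin 2 → ℝ`:
* `weilIncrement_cutoffProfile_fin_two_le` — the increments of `f = 𝟙_{[-a,a]}(v₀ξ₀ + v₁ξ₁)` are linear
  at the origin, `D_t(f) ≤ 12 (t/a)‖v‖²` on `[0, 2a]` (explicit `θ₀₀, θ₀₁, θ₁₁`, `1 − cos x ≤ x`, `|sin x| ≤ x`);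
* `archHead_fin_two_le` — the archimedean HEAD `∫_{(0,2a]} ρ D_t(f) ≤ 24‖v‖²` (`ρ ≤ 1/(2t) + 1` on `(0,1]`);
* `polar_fin_two_le` — the pole form `P(f) = 2(c ⬝ᵥ v)² ≤ 30‖v‖²`;
* **`galerkinForm_fin_two_le`** — `v ⬝ᵥ (ζ(a,1) v) ≤ (log(1/a) + 55)‖v‖²` (closed-form identity
  `galerkinForm_eq_closedForm` + Suzuki's tail bookkeeping `∫_{2a}^∞ dt/(2 sinh t) = ½ log(1/a) + O(a)`);
* **`secondRayleigh_zeta_fin_two_le`** — `ε₂(ζ(a,1)) ≤ log(1/a) + 55` (`secondRayleigh_le_of_plane`);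
* **`exists_log_sub_le_bottomRayleigh_zeta`**, **`exists_shortWindow_sandwich`** — `∃ c, a₀ > 0` with
  `log(1/a) − c ≤ ε₁(ζ(a,N))` (`a ≤ a₀`, all `N`), so at `(a,1)` both levels lie in
  `[log(1/a) − c, log(1/a) + 55]`: the gap stays bounded while `ε₁ → +∞` as `a → 0⁺`.
Consequences for the guarded ratio classes are drawn in `PfPersistenceRatioShortWindowSettled`.
RH-free throughout; no DATA.  References: Suzuki 2026 (arXiv:2606.09096) §4.2, §5.1, Thm. 1.4 as
formalised in `Literature/…/WeilWindowSuzukiAsymptoticProofs`; Connes–Consani arXiv:2106.01715,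
Lemma 2.6 (`θ_{nm}`, tree def `thetaEven`).
-/

set_option linter.dupNamespace false

noncomputable section

open Real Set MeasureTheory Matrix

namespace Summit.RiemannHypothesis.RiemannHypothesis.Theorems.PfPersistence

open Literature.NumberTheory.LFunctions

/-! ## §1 Elementary inequalities -/

/-- `1 − cos x ≤ x` for `x ≥ 0`. [folklore] -/
theorem one_sub_cos_le_self {x : ℝ} (hx : 0 ≤ x) : 1 - Real.cos x ≤ x := by
  by_cases h : x ≤ 2
  · nlinarith [Real.one_sub_sq_div_two_le_cos (x := x)]
  · linarith [Real.neg_one_le_cos x]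

/-- `−x ≤ sin x` for `x ≥ 0`. [folklore] -/
theorem neg_self_le_sin {x : ℝ} (hx : 0 ≤ x) : -x ≤ Real.sin x := by
  by_cases h : x ≤ π
  · linarith [Real.sin_nonneg_of_nonneg_of_le_pi hx h]
  · linarith [Real.neg_one_le_sin x, Real.pi_gt_three]

/-- `|sin x| ≤ x` for `x ≥ 0`. [folklore] -/
theorem abs_sin_le_self {x : ℝ} (hx : 0 ≤ x) : |Real.sin x| ≤ x :=
  abs_le.2 ⟨neg_self_le_sin hx, Real.sin_le hx⟩

/-- `cosh a − 1 ≤ a + a²` for `0 ≤ a ≤ 1` (`cosh ≤ exp`, `e^a ≤ 1 + a + a²`). [folklore] -/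
theorem cosh_sub_one_le {a : ℝ} (ha0 : 0 ≤ a) (ha1 : a ≤ 1) : Real.cosh a - 1 ≤ a + a ^ 2 := by
  have h1 : Real.cosh a ≤ Real.exp a := by
    rw [Real.cosh_eq]
    have := Real.exp_le_exp.2 (by linarith : -a ≤ a)
    linarith
  have h2 := Real.abs_exp_sub_one_sub_id_le (x := a) (by rwa [abs_of_nonneg ha0])
  have h3 := (abs_le.1 h2).2
  linarith

/-- `‖v‖² = v₀² + v₁²` on `Fin 2`. [folklore] -/
theorem dotProduct_self_fin_two (v : Fin 2 → ℝ) : v ⬝ᵥ v = v 0 ^ 2 + v 1 ^ 2 := by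
  simp [dotProduct, Fin.sum_univ_two, sq]

/-! ## §2 Increments of the two-dimensional cut-off profile are linear at the origin -/

/-- `θ₀₀(y) = (L − y)/L` (unfolding of `thetaEven`; Connes–Consani arXiv:2106.01715, Lemma 2.6). [folklore] -/
theorem thetaEven_val_zero_zero (L y : ℝ) : thetaEven L 0 0 y = (L - y) / L := by
  simp [thetaEven]

/-- `θ₀₁(y) = −sin(2πy/L)/(√2 π)` (unfolding of `thetaEven`). [folklore] -/
theorem thetaEven_val_zero_one (L y : ℝ) :
    thetaEven L 0 1 y = -Real.sin (2 * π * y / L) / (Real.sqrt 2 * π) := by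
  simp [thetaEven]

/-- `θ₁₀(y) = −sin(2πy/L)/(√2 π)` (unfolding of `thetaEven`). [folklore] -/
theorem thetaEven_val_one_zero (L y : ℝ) :
    thetaEven L 1 0 y = -Real.sin (2 * π * y / L) / (Real.sqrt 2 * π) := by
  simp [thetaEven]

/-- `θ₁₁(y) = (L − y)/L · cos(2πy/L) − sin(2πy/L)/(2π)` (unfolding of `thetaEven`). [folklore] -/
theorem thetaEven_val_one_one (L y : ℝ) :
    thetaEven L 1 1 y =
      (L - y) / L * Real.cos (2 * π * y / L) - Real.sin (2 * π * y / L) / (2 * π) := by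
  simp [thetaEven]

/-- The two-dimensional autocorrelation `A(y) = Σ vₙ θₙₘ(y) vₘ` written out. [folklore] -/
theorem autocorr_fin_two {L : ℝ} (hL : 0 < L) (v : Fin 2 → ℝ) (y : ℝ) :
    autocorr L v y =
      v 0 * ((L - y) / L) * v 0 + v 0 * (-Real.sin (2 * π * y / L) / (Real.sqrt 2 * π)) * v 1 +
        (v 1 * (-Real.sin (2 * π * y / L) / (Real.sqrt 2 * π)) * v 0 +
          v 1 * ((L - y) / L * Real.cos (2 * π * y / L) - Real.sin (2 * π * y / L) / (2 * π)) *
            v 1) := by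
  rw [← sum_thetaEven_eq_autocorr hL v y]
  simp [Fin.sum_univ_two, thetaEven_val_zero_zero, thetaEven_val_zero_one, thetaEven_val_one_zero,
    thetaEven_val_one_one]

/-- The scalar inequality behind `D_t ≤ 12(t/a)‖v‖²` (`x = 2πs ≥ 0`; `|v₀v₁| ≤ ‖v‖²/2`, `|sin x| ≤ x`,
`1 − cos x ≤ x ≤ 8s`, `cos x ≤ 1`). [folklore] -/
theorem fin_two_increment_aux {v0 v1 s x : ℝ} (hs0 : 0 ≤ s) (hx : x = 2 * π * s) :
    2 * s * v0 ^ 2 + 4 * (v0 * v1) * (Real.sin x / (Real.sqrt 2 * π)) +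
        2 * v1 ^ 2 * (1 - Real.cos x) + 2 * s * v1 ^ 2 * Real.cos x +
          v1 ^ 2 * (Real.sin x / π) ≤
      24 * s * (v0 ^ 2 + v1 ^ 2) := by
  have hx0 : 0 ≤ x := by rw [hx]; positivity
  have hx8 : x ≤ 8 * s := by rw [hx]; nlinarith [Real.pi_le_four]
  have hcos1 : Real.cos x ≤ 1 := Real.cos_le_one x
  have h1c : 1 - Real.cos x ≤ x := one_sub_cos_le_self hx0
  have hsinabs : |Real.sin x| ≤ x := abs_sin_le_self hx0
  have hsin : Real.sin x ≤ x := Real.sin_le hx0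
  have hν0 : 0 ≤ v0 ^ 2 + v1 ^ 2 := by positivity
  -- the cross term
  have hcross : 4 * (v0 * v1) * (Real.sin x / (Real.sqrt 2 * π)) ≤ 4 * s * (v0 ^ 2 + v1 ^ 2) := by
    have h1 : |v0 * v1| ≤ (v0 ^ 2 + v1 ^ 2) / 2 := by
      rw [abs_le]; constructor <;> nlinarith [sq_nonneg (v0 + v1), sq_nonneg (v0 - v1)]
    have h2 : |v0 * v1 * Real.sin x| ≤ (v0 ^ 2 + v1 ^ 2) / 2 * x := by
      rw [abs_mul]; exact mul_le_mul h1 hsinabs (abs_nonneg _) (by positivity)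
    have h3 : v0 * v1 * Real.sin x ≤ (v0 ^ 2 + v1 ^ 2) / 2 * x := (le_abs_self _).trans h2
    have hπ2 : π ≤ Real.sqrt 2 * π := by nlinarith [Real.one_lt_sqrt_two, Real.pi_pos]
    have h4 : 1 / (Real.sqrt 2 * π) ≤ 1 / π := one_div_le_one_div_of_le Real.pi_pos hπ2
    have h5 : 0 ≤ (v0 ^ 2 + v1 ^ 2) / 2 * x := mul_nonneg (by positivity) hx0
    have h6 : 4 * (v0 * v1 * Real.sin x) * (1 / (Real.sqrt 2 * π)) ≤
        4 * ((v0 ^ 2 + v1 ^ 2) / 2 * x) * (1 / π) :=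
      mul_le_mul (by linarith) h4 (by positivity) (by linarith)
    have h7 : 4 * ((v0 ^ 2 + v1 ^ 2) / 2 * x) * (1 / π) = 4 * s * (v0 ^ 2 + v1 ^ 2) := by
      rw [hx]; field_simp
    have h8 : 4 * (v0 * v1) * (Real.sin x / (Real.sqrt 2 * π)) =
        4 * (v0 * v1 * Real.sin x) * (1 / (Real.sqrt 2 * π)) := by ring
    linarith
  -- the `v₁²` terms
  have hv1a : 2 * v1 ^ 2 * (1 - Real.cos x) ≤ 16 * s * v1 ^ 2 := by
    have h := mul_le_mul_of_nonneg_left h1c (by positivity : (0:ℝ) ≤ 2 * v1 ^ 2)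
    have h' := mul_le_mul_of_nonneg_left hx8 (sq_nonneg v1)
    linarith
  have hv1b : 2 * s * v1 ^ 2 * Real.cos x ≤ 2 * s * v1 ^ 2 := by
    have h := mul_le_mul_of_nonneg_left hcos1 (by positivity : (0:ℝ) ≤ 2 * s * v1 ^ 2)
    linarith
  have hv1c : v1 ^ 2 * (Real.sin x / π) ≤ 2 * s * v1 ^ 2 := by
    have h : Real.sin x / π ≤ x / π := div_le_div_of_nonneg_right hsin Real.pi_pos.le
    have h' : x / π = 2 * s := by rw [hx]; field_simp
    rw [h'] at h
    have h'' := mul_le_mul_of_nonneg_left h (sq_nonneg v1)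
    linarith
  have hv0 : 0 ≤ s * v0 ^ 2 := mul_nonneg hs0 (sq_nonneg v0)
  linarith

/-- **PROVED (RH-free): `D_t(f) ≤ 12 (t/a) ‖v‖²` on `0 ≤ t ≤ 2a`** for the cut-off profile
`f = 𝟙_{[-a,a]}(v₀ ξ₀ + v₁ ξ₁)` of the window `(a, 1)` (`weilIncrement_cutoffProfile_of_le`, `autocorr_fin_two`,
`fin_two_increment_aux` with `s = t/(2a)`, `x = 2πs`). [folklore] -/
theorem weilIncrement_cutoffProfile_fin_two_le {a : ℝ} (ha : 0 < a) (v : Fin 2 → ℝ) {t : ℝ}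
    (ht0 : 0 ≤ t) (ht : t ≤ 2 * a) :
    weilIncrement (cutoffProfile ⟨a, 1, ha⟩ v) t ≤ 12 * t / a * (v ⬝ᵥ v) := by
  have h2a : 0 < 2 * a := by positivity
  have hD : weilIncrement (cutoffProfile ⟨a, 1, ha⟩ v) t =
      2 * (v ⬝ᵥ v) - 2 * autocorr (2 * a) v t :=
    weilIncrement_cutoffProfile_of_le ⟨a, 1, ha⟩ v ht0 ht
  rw [hD, dotProduct_self_fin_two, autocorr_fin_two h2a v t]
  have hs0 : 0 ≤ t / (2 * a) := div_nonneg ht0 h2a.le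
  have hxs : 2 * π * t / (2 * a) = 2 * π * (t / (2 * a)) := by ring
  have haux := fin_two_increment_aux (v0 := v 0) (v1 := v 1) hs0 hxs
  have h12 : 12 * t / a * (v 0 ^ 2 + v 1 ^ 2) = 24 * (t / (2 * a)) * (v 0 ^ 2 + v 1 ^ 2) := by
    field_simp; ring
  rw [h12]
  generalize hX : 2 * π * t / (2 * a) = X at haux ⊢
  have ha0 : a ≠ 0 := ha.ne'
  have hπ : (π : ℝ) ≠ 0 := Real.pi_ne_zero
  have hr2 : Real.sqrt 2 ≠ 0 := by positivity
  have key : 2 * (v 0 ^ 2 + v 1 ^ 2) -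
      2 * (v 0 * ((2 * a - t) / (2 * a)) * v 0 +
        v 0 * (-Real.sin X / (Real.sqrt 2 * π)) * v 1 +
        (v 1 * (-Real.sin X / (Real.sqrt 2 * π)) * v 0 +
          v 1 * ((2 * a - t) / (2 * a) * Real.cos X - Real.sin X / (2 * π)) * v 1)) =
      2 * (t / (2 * a)) * v 0 ^ 2 + 4 * (v 0 * v 1) * (Real.sin X / (Real.sqrt 2 * π)) +
        2 * v 1 ^ 2 * (1 - Real.cos X) + 2 * (t / (2 * a)) * v 1 ^ 2 * Real.cos X +
          v 1 ^ 2 * (Real.sin X / π) := by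
    field_simp
    ring
  rw [key]
  exact haux

/-! ## §3 The archimedean head and the polar block at the window `(a, 1)` -/

/-- **PROVED (RH-free): the archimedean HEAD is bounded**: for `0 < a ≤ 1/4`,
`∫_{(0,2a]} ρ(t) D_t(f) dt ≤ 24 ‖v‖²` (`ρ ≤ 1/(2t) + 1` on `(0,1]`, `D_t ≤ 12(t/a)‖v‖²`). [folklore] -/
theorem archHead_fin_two_le {a : ℝ} (ha : 0 < a) (h4 : a ≤ 1 / 4) (v : Fin 2 → ℝ) :
    ∫ t in Ioc 0 (2 * a), weilArchDensity t * weilIncrement (cutoffProfile ⟨a, 1, ha⟩ v) t ≤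
      24 * (v ⬝ᵥ v) := by
  set N : ℝ := v ⬝ᵥ v with hN
  have hN0 : 0 ≤ N := by rw [hN, dotProduct_self_fin_two]; positivity
  have h2a : 0 < 2 * a := by positivity
  set D : ℝ → ℝ := weilIncrement (cutoffProfile ⟨a, 1, ha⟩ v) with hD
  have hpt : ∀ t ∈ Ioc (0:ℝ) (2 * a), ‖weilArchDensity t * D t‖ ≤ 6 * N / a + 24 * N := by
    intro t ht
    have ht0 : 0 < t := ht.1
    have ht1 : t ≤ 1 := by linarith [ht.2]
    have hρ0 : 0 ≤ weilArchDensity t := (weilArchDensity_pos ht0).le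
    have hρ : weilArchDensity t ≤ 1 / (2 * t) + 1 := by
      have := (abs_le.1 (abs_weilArchDensity_sub_le ht0 ht1)).2
      linarith
    have hD0 : 0 ≤ D t := weilIncrement_nonneg _ t
    have hDle : D t ≤ 12 * t / a * N := weilIncrement_cutoffProfile_fin_two_le ha v ht0.le ht.2
    rw [norm_mul, Real.norm_of_nonneg hρ0, Real.norm_of_nonneg hD0]
    calc weilArchDensity t * D t ≤ (1 / (2 * t) + 1) * (12 * t / a * N) :=
          mul_le_mul hρ hDle hD0 (by positivity)
      _ = 6 * N / a + 12 * t / a * N := by field_simp; ring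
      _ ≤ 6 * N / a + 24 * N := by
          have h1 : 12 * t / a * N ≤ 12 * (2 * a) / a * N := by
            apply mul_le_mul_of_nonneg_right _ hN0
            exact div_le_div_of_nonneg_right (by linarith [ht.2]) ha.le
          have h2 : 12 * (2 * a) / a * N = 24 * N := by field_simp; ring
          linarith
  have h := norm_setIntegral_le_of_norm_le_const
    (measure_Ioc_lt_top : volume (Ioc (0:ℝ) (2 * a)) < ⊤) hpt
  rw [Real.volume_real_Ioc_of_le h2a.le, sub_zero, Real.norm_eq_abs] at h
  have h' := le_abs_self (∫ t in Ioc 0 (2 * a), weilArchDensity t * D t)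
  have h3 : (6 * N / a + 24 * N) * (2 * a) = 12 * N + 48 * a * N := by field_simp; ring
  nlinarith [mul_le_mul_of_nonneg_right h4 hN0]

open PolarRankOne in
/-- **PROVED (RH-free): the polar block is bounded at short windows**: for `0 < a ≤ 1/4`,
`P(f) = 2 (c ⬝ᵥ v)² ≤ 30 ‖v‖²` at the window `(a, 1)` (`c_n = √(ρ/2) g_n`, `ρ = (cosh a − 1)/a ≤ 5/4`,
`g₀² = 8`, `g₁² ≤ 16`). [folklore] -/
theorem polar_fin_two_le {a : ℝ} (ha : 0 < a) (h4 : a ≤ 1 / 4) (v : Fin 2 → ℝ) :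
    2 * (polarVec ⟨a, 1, ha⟩ ⬝ᵥ v) ^ 2 ≤ 30 * (v ⬝ᵥ v) := by
  rw [dotProduct_self_fin_two]
  have hdot : polarVec ⟨a, 1, ha⟩ ⬝ᵥ v =
      Real.sqrt (polarScale (2 * a) / 2) * (polarGen (2 * a) 0 * v 0 + polarGen (2 * a) 1 * v 1) := by
    simp [dotProduct, Fin.sum_univ_two, polarVec]
    ring
  set r : ℝ := Real.sqrt (polarScale (2 * a) / 2) with hr
  set g0 : ℝ := polarGen (2 * a) 0 with hg0
  set g1 : ℝ := polarGen (2 * a) 1 with hg1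
  have hρ : polarScale (2 * a) / 2 = (Real.cosh a - 1) / (2 * a) := by
    rw [polarScale, show 2 * a / 2 = a by ring]; field_simp
  have hρ0 : 0 ≤ polarScale (2 * a) / 2 := by
    rw [hρ]; exact div_nonneg (by linarith [Real.one_le_cosh a]) (by positivity)
  have hr2 : r ^ 2 = polarScale (2 * a) / 2 := by rw [hr, Real.sq_sqrt hρ0]
  have hr2le : r ^ 2 ≤ 5 / 8 := by
    rw [hr2, hρ, div_le_div_iff₀ (by positivity) (by norm_num)]
    have hc := cosh_sub_one_le ha.le (by linarith)
    nlinarith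
  have hg0sq : g0 ^ 2 = 8 := by
    rw [hg0, polarGen]; simp
    rw [mul_pow, Real.sq_sqrt (by norm_num)]; norm_num
  have hg1sq : g1 ^ 2 ≤ 16 := by
    have hD : 1 / 4 ≤ Dk (2 * π * 1 / (2 * a)) := by unfold Dk; nlinarith [sq_nonneg (2 * π * 1 / (2 * a))]
    have hDp : 0 < Dk (2 * π * 1 / (2 * a)) := Dk_pos _
    have hg1' : g1 = 1 / Dk (2 * π * 1 / (2 * a)) := by rw [hg1, polarGen]; simp
    have hg1le : g1 ≤ 4 := by
      rw [hg1', div_le_iff₀ hDp]; linarith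
    have hg1nn : 0 ≤ g1 := by rw [hg1']; positivity
    nlinarith
  rw [hdot]
  have hcs : (g0 * v 0 + g1 * v 1) ^ 2 ≤ (g0 ^ 2 + g1 ^ 2) * (v 0 ^ 2 + v 1 ^ 2) := by
    nlinarith [sq_nonneg (g0 * v 1 - g1 * v 0)]
  have hν0 : 0 ≤ v 0 ^ 2 + v 1 ^ 2 := by positivity
  calc 2 * (r * (g0 * v 0 + g1 * v 1)) ^ 2 = 2 * r ^ 2 * (g0 * v 0 + g1 * v 1) ^ 2 := by ring
    _ ≤ 2 * (5 / 8) * ((g0 ^ 2 + g1 ^ 2) * (v 0 ^ 2 + v 1 ^ 2)) := by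
        apply mul_le_mul (by nlinarith [sq_nonneg r]) hcs (sq_nonneg _) (by norm_num)
    _ ≤ 2 * (5 / 8) * (24 * (v 0 ^ 2 + v 1 ^ 2)) := by
        apply mul_le_mul_of_nonneg_left _ (by norm_num)
        exact mul_le_mul_of_nonneg_right (by linarith) hν0
    _ = 30 * (v 0 ^ 2 + v 1 ^ 2) := by ring

/-! ## §4 The upper bound `v ⬝ᵥ (ζ(a,1) v) ≤ (log(1/a) + 55) ‖v‖²` -/

/-- **PROVED (RH-free): THE SHORT-WINDOW CEILING of `ζ`'s two-dimensional block.**  For `0 < a ≤ 1/4`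
and every `v : Fin 2 → ℝ`, `v ⬝ᵥ (zetaDatum (a, 1) · v) ≤ (log(1/a) + 55) ‖v‖²`.  Proof: the Galerkin
closed-form identity `vᵀζv = P(f) + 𝓔_a(f) − M_a‖f‖²` (`galerkinForm_eq_closedForm`, no primes below
`a ≤ 1/4`); the energy splits at `2a` into the HEAD (`≤ 24‖v‖²`) and the TAIL `2‖v‖² ∫_{2a}^∞ ρ`, whose
`1/(2 sinh)` part is `−log tanh a ≤ log(1/a) + a` (`integral_Ioi_inv_two_sinh`, `abs_neg_log_tanh_sub_log_inv_le`)
and whose killing part cancels against `M_a` up to a non-negative head; `P ≤ 30‖v‖²`; `log 4π + γ ≥ 0`.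
[cite: Suzuki2026, §4.2 (EQ_405), §5.1 (EQ_501)] -/
theorem galerkinForm_fin_two_le {a : ℝ} (ha : 0 < a) (h4 : a ≤ 1 / 4) (v : Fin 2 → ℝ) :
    v ⬝ᵥ (zetaDatum ⟨a, 1, ha⟩ *ᵥ v) ≤ (Real.log (1 / a) + 55) * (v ⬝ᵥ v) := by
  set N : ℝ := v ⬝ᵥ v with hN
  have hN0 : 0 ≤ N := by rw [hN, dotProduct_self_fin_two]; positivity
  have ha1 : a ≤ 1 := by linarith
  have h2a : 0 < 2 * a := by positivity
  set f : ℝ → ℂ := cutoffProfile ⟨a, 1, ha⟩ v with hf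
  set D : ℝ → ℝ := weilIncrement f with hD
  set kil : ℝ → ℝ := fun t ↦ (Real.exp (t / 2) - 1) / (2 * Real.sinh t) with hkil
  set κI : ℝ := ∫ t in Ioi (0 : ℝ), kil t with hκI
  have hQ : v ⬝ᵥ (zetaDatum ⟨a, 1, ha⟩ *ᵥ v) =
      weilPoleForm f + (∫ t in Ioi (0 : ℝ), weilArchDensity t * D t) -
        (2 * κI + (Real.log (4 * π) + Real.eulerMascheroniConstant)) * N := by
    have h := galerkinForm_eq_closedForm ⟨a, 1, ha⟩ v
    dsimp only at h
    rw [weilDirichletEnergy_eq_of_le_quarter h4, weilMarkovConstant_eq_of_le_quarter h4,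
      integral_norm_sq_cutoffProfile] at h
    rw [h]
  have hED : IntegrableOn (fun t ↦ weilArchDensity t * D t) (Ioi 0) :=
    integrableOn_archEnergy_cutoffProfile ⟨a, 1, ha⟩ v
  have hK : IntegrableOn kil (Ioi 0) := integrableOn_weilKillingDensity
  have hunion : Ioc 0 (2 * a) ∪ Ioi (2 * a) = Ioi 0 := Ioc_union_Ioi_eq_Ioi h2a.le
  have hdisj : Disjoint (Ioc 0 (2 * a)) (Ioi (2 * a)) :=
    disjoint_left.2 fun t ht ht' ↦ (not_lt.2 ht.2) ht'
  have hIoc_sub : Ioc 0 (2 * a) ⊆ Ioi 0 := Ioc_subset_Ioi_self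
  have hIoi_sub : Ioi (2 * a) ⊆ Ioi 0 := Ioi_subset_Ioi h2a.le
  have hE_split : ∫ t in Ioi (0 : ℝ), weilArchDensity t * D t =
      (∫ t in Ioc 0 (2 * a), weilArchDensity t * D t) +
        ∫ t in Ioi (2 * a), weilArchDensity t * D t := by
    rw [← hunion, setIntegral_union hdisj measurableSet_Ioi (hED.mono_set hIoc_sub)
      (hED.mono_set hIoi_sub)]
  have htailD : ∫ t in Ioi (2 * a), weilArchDensity t * D t =
      2 * N * ∫ t in Ioi (2 * a), weilArchDensity t := by
    rw [← integral_const_mul]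
    refine setIntegral_congr_fun measurableSet_Ioi fun t ht ↦ ?_
    rw [hD, hf, weilIncrement_cutoffProfile_of_ge ⟨a, 1, ha⟩ v (le_of_lt ht)]
    ring
  obtain ⟨hSint, hSval⟩ := integral_Ioi_inv_two_sinh ha
  have htailDens : ∫ t in Ioi (2 * a), weilArchDensity t =
      (∫ t in Ioi (2 * a), 1 / (2 * Real.sinh t)) + ∫ t in Ioi (2 * a), kil t := by
    rw [← integral_add hSint (hK.mono_set hIoi_sub)]
    refine setIntegral_congr_fun measurableSet_Ioi fun t ht ↦ ?_
    have hs : Real.sinh t ≠ 0 := (Real.sinh_pos_iff.2 (h2a.trans ht)).ne'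
    simp only [hkil, weilArchDensity]
    field_simp
    ring
  have hK_split : κI = (∫ t in Ioc 0 (2 * a), kil t) + ∫ t in Ioi (2 * a), kil t := by
    rw [hκI, ← hunion, setIntegral_union hdisj measurableSet_Ioi (hK.mono_set hIoc_sub)
      (hK.mono_set hIoi_sub)]
  have hE2_nonneg : 0 ≤ ∫ t in Ioc 0 (2 * a), kil t :=
    setIntegral_nonneg measurableSet_Ioc fun t ht ↦ weilKillingDensity_nonneg ht.1
  have hhead : ∫ t in Ioc 0 (2 * a), weilArchDensity t * D t ≤ 24 * N := archHead_fin_two_le ha h4 v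
  have hP : weilPoleForm f ≤ 30 * N := by
    rw [hf, weilPoleForm_cutoffProfile]; exact polar_fin_two_le ha h4 v
  have hlog := (abs_le.1 (abs_neg_log_tanh_sub_log_inv_le ha ha1)).2
  have hγ : 0 ≤ Real.log (4 * π) + Real.eulerMascheroniConstant := by
    have h1 : 0 ≤ Real.log (4 * π) := Real.log_nonneg (by nlinarith [Real.pi_gt_three])
    linarith [Real.one_half_lt_eulerMascheroniConstant]
  have key : v ⬝ᵥ (zetaDatum ⟨a, 1, ha⟩ *ᵥ v) =
      weilPoleForm f + (∫ t in Ioc 0 (2 * a), weilArchDensity t * D t) +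
        N * (-(Real.log (Real.sinh a) - Real.log (Real.cosh a))) -
        2 * N * (∫ t in Ioc 0 (2 * a), kil t) -
        (Real.log (4 * π) + Real.eulerMascheroniConstant) * N := by
    rw [hQ, hE_split, htailD, htailDens, hSval, hK_split]
    ring
  rw [key]
  have h1 : N * (-(Real.log (Real.sinh a) - Real.log (Real.cosh a))) ≤ N * (Real.log (1 / a) + a) :=
    mul_le_mul_of_nonneg_left (by linarith) hN0
  have h2 : 0 ≤ 2 * N * ∫ t in Ioc 0 (2 * a), kil t := by positivity
  have h3 : 0 ≤ (Real.log (4 * π) + Real.eulerMascheroniConstant) * N := mul_nonneg hγ hN0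
  nlinarith [mul_le_mul_of_nonneg_right h4 hN0]

/-! ## §5 The second level is capped and the bottom is floored by `log(1/a) + O(1)` -/

/-- **PROVED (RH-free): `ε₂(ζ(a, 1)) ≤ log(1/a) + 55`** for `0 < a ≤ 1/4` (plane cap on the whole
two-dimensional coefficient space, `secondRayleigh_le_of_plane`). [folklore] -/
theorem secondRayleigh_zeta_fin_two_le {a : ℝ} (ha : 0 < a) (h4 : a ≤ 1 / 4) :
    secondRayleigh (zetaDatum ⟨a, 1, ha⟩) ≤ Real.log (1 / a) + 55 := by
  have hx : (Pi.single 0 1 : Fin 2 → ℝ) ≠ 0 := by intro h; have := congrFun h 0; simp at this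
  have hy : (Pi.single 1 1 : Fin 2 → ℝ) ≠ 0 := by intro h; have := congrFun h 1; simp at this
  have hxy : (Pi.single 1 1 : Fin 2 → ℝ) ⬝ᵥ (Pi.single 0 1 : Fin 2 → ℝ) = 0 := by simp
  exact secondRayleigh_le_of_plane (M := zetaDatum ⟨a, 1, ha⟩) hx hy hxy
    fun α β => galerkinForm_fin_two_le ha h4 _

/-- **PROVED (RH-free): Suzuki's floor under every Galerkin bottom.**  There are `c` and `a₀ > 0` with
`log(1/a) − c ≤ ε₁(ζ(a, N))` for all `0 < a ≤ a₀` and every `N` (`Suzuki2026_thm_1_4_asymptotic_holds`,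
`μ₁ > 0`, then `ε ≤ ε_ev ≤ ε₁(ζ(a,N))`: `weilGroundEnergy_le_weilEvenGroundEnergy`, GAL‑0
`weilEvenGroundEnergy_le_bottomRayleigh'`). [cite: Suzuki2026, Thm. 1.4] -/
theorem exists_log_sub_le_bottomRayleigh_zeta :
    ∃ c a₀ : ℝ, 0 < a₀ ∧ a₀ ≤ 1 / 5 ∧ ∀ (a : ℝ) (ha : 0 < a), a ≤ a₀ → ∀ N : ℕ,
      Real.log (1 / a) - c ≤ bottomRayleigh (zetaDatum ⟨a, N, ha⟩) := by
  obtain ⟨μ₁, hμ₁, C, a₀, ha₀, H⟩ := Suzuki2026_thm_1_4_asymptotic_holds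
  refine ⟨Real.log (2 * Real.pi) + Real.eulerMascheroniConstant + |C| * a₀, min a₀ (1 / 5),
    lt_min ha₀ (by norm_num), min_le_right _ _, fun a ha hale N => ?_⟩
  have haa₀ : a ≤ a₀ := hale.trans (min_le_left _ _)
  have h := (abs_le.1 (H a ha haa₀)).1
  have hCa : C * a ≤ |C| * a₀ := by
    calc C * a ≤ |C| * a := mul_le_mul_of_nonneg_right (le_abs_self C) ha.le
      _ ≤ |C| * a₀ := mul_le_mul_of_nonneg_left haa₀ (abs_nonneg C)
  have h1 := weilGroundEnergy_le_weilEvenGroundEnergy a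
  have h2 := weilEvenGroundEnergy_le_bottomRayleigh' ⟨a, N, ha⟩
  dsimp only at h2
  linarith

/-- **PROVED (RH-free): THE SHORT-WINDOW SANDWICH at `(a, 1)`.**  There are `c` and `a₀ ∈ (0, 1/5]` with
`log(1/a) − c ≤ ε₁(ζ(a,1)) ≤ ε₂(ζ(a,1)) ≤ log(1/a) + 55` for all `0 < a ≤ a₀`: both levels are
`log(1/a) + O(1)`, the gap `ε₂ − ε₁ ≤ 55 + c` is bounded while `ε₁ → +∞` as `a → 0⁺`. [folklore] -/
theorem exists_shortWindow_sandwich :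
    ∃ c a₀ : ℝ, 0 < a₀ ∧ a₀ ≤ 1 / 5 ∧ ∀ (a : ℝ) (ha : 0 < a), a ≤ a₀ →
      Real.log (1 / a) - c ≤ bottomRayleigh (zetaDatum ⟨a, 1, ha⟩) ∧
        bottomRayleigh (zetaDatum ⟨a, 1, ha⟩) ≤ secondRayleigh (zetaDatum ⟨a, 1, ha⟩) ∧
        secondRayleigh (zetaDatum ⟨a, 1, ha⟩) ≤ Real.log (1 / a) + 55 := by
  obtain ⟨c, a₀, ha₀, ha₅, H⟩ := exists_log_sub_le_bottomRayleigh_zeta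
  refine ⟨c, a₀, ha₀, ha₅, fun a ha hale => ⟨H a ha hale 1, ?_, ?_⟩⟩
  · exact bottomRayleigh_le_secondRayleigh (n := 1) one_pos _
  · exact secondRayleigh_zeta_fin_two_le ha (by linarith [hale.trans ha₅])

end Summit.RiemannHypothesis.RiemannHypothesis.Theorems.PfPersistence
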